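import Mathlib
import Summits.NavierStokesRegularity.NavierStokesRegularity.Theorems.FilamentSkeletonRssClause13ModelFarSmoothing
import Summits.NavierStokesRegularity.NavierStokesRegularity.Theorems.FilamentSkeletonRssClause13ModelFarBranch
import Summits.NavierStokesRegularity.NavierStokesRegularity.Theorems.FilamentSkeletonRssClause13ModelPieceBandPrelim

/-!
# Clause 13-J/13-R, brick n3 LAYER C (FAR PIECE): the energy estimate for `Y_H = Y − k∗Y` (spectrum in `|z|√q ≥ X`)

Route `FilamentSkeletonRss`, ∃-side clause 13 (`Clause13RNearStraightL` stmt-NavierStokesRegularity-23612; typing-agnostic); design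
`filament-plan/DESIGN-28296-model-gluing-g16.md` §1/§3 (window H) and v2 addendum §A/§C (task C5).  With `k` the "near" kernel (profile `χ = 1`
on `|z|√q < X`) the far piece `Y_H = Y − k∗Y` has spectrum in `|z|√q ≥ X`, where transport beats every Cauchy–Schwarz bound; it is estimated by
the far-branch ENERGY identity `model_farBranch_energy` (p696498: rotation normal form `Z = Y_H + θ·conj Y_H`, `θ = β₂/(2iG′)`, `G′ = 2G/q`,
J-averaged growth `β₀ ≤ ½w′ + Re β₁`), with the non-local part of `M_q` as the remainder `Rm = −iG·K_q∗Y_H`, small by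
`integral_sq_norm_smoothingPiece_far_le` (p703600: `‖K_q∗Y_H‖₂ ≤ η_X‖Y_H‖₂`, `η_X = (2/q)5e^{−X/2}`).  Result (`ε = b₂q/(4G) ≤ 1`, `ℓ = L₂q/(4G)`):
`β₀(1−ε)²‖Y_H‖₂² ≤ (1+ε)‖Y_H‖₂·[(1+ε)‖𝓛Y_H‖₂ + ((1+ε)Gη_X + 2b₁ε + 2G′ε²)‖Y_H‖₂ + ℓΛ‖(τ−c)Y_H‖₂]`.
* §1 scalar bookkeeping (`far_letOperator_eq`, `far_pointwise_bound`): the pointwise size of the energy integrand;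
* §2 `integral_le_of_pointwise_far`: integrating such a pointwise bound with Cauchy–Schwarz;
* §3 `model_piece_far_estimate`.
(`‖𝓛Y_H‖₂` is bounded in terms of `‖𝓛Y‖₂` and transition pieces in a separate file.)
Lane ns-filament-19175-p1 g16; `--supports stmt-NavierStokesRegularity-23612 --as helper`.
HONEST FRAMING: bookkeeping about an explicit 1-D model operator attached to a HYPOTHETICAL filament skeleton on the NEGATIVE side of a MODEL route;
nothing here bears on Navier–Stokes regularity or blow-up.
-/

noncomputable section

open MeasureTheory Real Complex Filter Set
open scoped ComplexConjugate Topology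

namespace Summit.NavierStokesRegularity.NavierStokesRegularity.Theorems.MatchedKernel
set_option linter.dupNamespace false

/-! ## §1 Scalar bookkeeping for the far-branch integrand -/

/-- The let-operator of `model_farBranch_energy` with `G′ = 2G/q`, `θ = m/(2iG′)`, `Rm = −iGκ` is the model operator value
`iG((2/q)u − κ) − ωu′ + pu + m·conj u`. [folklore] -/
theorem far_letOperator_eq {G q : ℝ} (hG : 0 < G) (hq : 0 < q) (u u' κ p m : ℂ) (ω : ℝ) :
    I * ((2 * G / q : ℝ) : ℂ) * u - (ω : ℂ) * u' + p * u + (2 * I * ((2 * G / q : ℝ) : ℂ) * (m / (2 * I * ((2 * G / q : ℝ) : ℂ)))) * conj u + (-(I * (G : ℂ) * κ))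
      = (I * (G : ℂ) * ((2 / q : ℂ) * u - κ) - (ω : ℂ) * u' + p * u + m * conj u) := by
  have hG'0 : (2 * I * ((2 * G / q : ℝ) : ℂ)) ≠ 0 := by
    refine mul_ne_zero (mul_ne_zero two_ne_zero Complex.I_ne_zero) ?_
    exact_mod_cast (by positivity : (0 : ℝ) < 2 * G / q).ne'
  rw [mul_div_cancel₀ _ hG'0]
  push_cast
  ring

/-- **Pointwise bound for the far-branch energy integrand.**  Scalars: `u = Y_H(τ)`, `u′ = Y_H′(τ)`, `κ = (K_q∗Y_H)(τ)`, `p = β₁(τ)`,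
`m = β₂(τ)`, `m′ = β₂′(τ)`, `ω = w(τ)` with `|ω| ≤ Λ|s|` (`s = τ − c`), `‖p‖ ≤ b₁`, `‖m‖ ≤ b₂`, `‖m′‖ ≤ L₂`; `θ = m/(2iG′)`, `Z = u + θ·conj u`,
`Z′ = u′ + θ′conj u + θ conj u′`, `S = iG′Z − ωZ′ + pZ`.  Then with `ε = b₂q/(4G)`, `ℓ = L₂q/(4G)`, `L = iG((2/q)u−κ) − ωu′ + pu + m conj u`:
`‖S·conj Z‖ ≤ (1+ε)‖u‖·((1+ε)‖L‖ + (1+ε)‖iGκ‖ + ℓΛ‖s·u‖ + (2b₁ε + 2G′ε²)‖u‖)`. [folklore] -/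
theorem far_pointwise_bound {G q Λ b₁ b₂ L₂ s ω : ℝ} (hG : 0 < G) (hq : 0 < q) (hΛ : 0 ≤ Λ) {u u' κ p m m' : ℂ}
    (hω : |ω| ≤ Λ * |s|) (hp : ‖p‖ ≤ b₁) (hm : ‖m‖ ≤ b₂) (hm' : ‖m'‖ ≤ L₂)
    (hS2 : (I * ((2 * G / q : ℝ) : ℂ) * u - (ω : ℂ) * u' + p * u + (2 * I * ((2 * G / q : ℝ) : ℂ) * (m / (2 * I * ((2 * G / q : ℝ) : ℂ)))) * conj u + (-(I * (G : ℂ) * κ)))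
      - (I * ((2 * G / q : ℝ) : ℂ) * (u + (m / (2 * I * ((2 * G / q : ℝ) : ℂ))) * conj u) - (ω : ℂ) * (u' + (m' / (2 * I * ((2 * G / q : ℝ) : ℂ))) * conj u + (m / (2 * I * ((2 * G / q : ℝ) : ℂ))) * conj u') + p * (u + (m / (2 * I * ((2 * G / q : ℝ) : ℂ))) * conj u))
      = ((-(I * (G : ℂ) * κ)) + (m / (2 * I * ((2 * G / q : ℝ) : ℂ))) * conj (-(I * (G : ℂ) * κ)) - (m / (2 * I * ((2 * G / q : ℝ) : ℂ))) * conj (I * ((2 * G / q : ℝ) : ℂ) * u - (ω : ℂ) * u' + p * u + (2 * I * ((2 * G / q : ℝ) : ℂ) * (m / (2 * I * ((2 * G / q : ℝ) : ℂ)))) * conj u + (-(I * (G : ℂ) * κ)))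
        + (ω * (m' / (2 * I * ((2 * G / q : ℝ) : ℂ))) + (m / (2 * I * ((2 * G / q : ℝ) : ℂ))) * conj p - p * (m / (2 * I * ((2 * G / q : ℝ) : ℂ)))) * conj u + (m / (2 * I * ((2 * G / q : ℝ) : ℂ))) * conj (2 * I * ((2 * G / q : ℝ) : ℂ) * (m / (2 * I * ((2 * G / q : ℝ) : ℂ)))) * u)) :
    ‖(I * ((2 * G / q : ℝ) : ℂ) * (u + (m / (2 * I * ((2 * G / q : ℝ) : ℂ))) * conj u) - (ω : ℂ) * (u' + (m' / (2 * I * ((2 * G / q : ℝ) : ℂ))) * conj u + (m / (2 * I * ((2 * G / q : ℝ) : ℂ))) * conj u') + p * (u + (m / (2 * I * ((2 * G / q : ℝ) : ℂ))) * conj u)) * conj (u + (m / (2 * I * ((2 * G / q : ℝ) : ℂ))) * conj u)‖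
      ≤ (1 + b₂ * q / (4 * G)) * (‖u‖ * ((1 + b₂ * q / (4 * G)) * ‖(I * (G : ℂ) * ((2 / q : ℂ) * u - κ) - (ω : ℂ) * u' + p * u + m * conj u)‖
          + (1 + b₂ * q / (4 * G)) * ‖(-(I * (G : ℂ) * κ))‖ + L₂ * q / (4 * G) * Λ * ‖(s : ℂ) * u‖
          + (2 * b₁ * (b₂ * q / (4 * G)) + 2 * (2 * G / q) * (b₂ * q / (4 * G)) ^ 2) * ‖u‖)) := by
  have hb10 : 0 ≤ b₁ := (norm_nonneg _).trans hp
  have hGp : 0 < 2 * G / q := by positivity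
  have hnorm : ‖(2 * I * ((2 * G / q : ℝ) : ℂ))‖ = 2 * (2 * G / q) := by
    rw [norm_mul, norm_mul, Complex.norm_two, Complex.norm_I, mul_one, Complex.norm_real, Real.norm_of_nonneg hGp.le]
  set ε : ℝ := b₂ * q / (4 * G) with hεdef
  set ℓ : ℝ := L₂ * q / (4 * G) with hℓdef
  set θ : ℂ := (m / (2 * I * ((2 * G / q : ℝ) : ℂ))) with hθdef
  set θ' : ℂ := (m' / (2 * I * ((2 * G / q : ℝ) : ℂ))) with hθ'def
  set L : ℂ := (I * (G : ℂ) * ((2 / q : ℂ) * u - κ) - (ω : ℂ) * u' + p * u + m * conj u) with hLdef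
  set R : ℂ := (-(I * (G : ℂ) * κ)) with hRdef
  have hb20 : 0 ≤ b₂ := (norm_nonneg _).trans hm
  have hL20 : 0 ≤ L₂ := (norm_nonneg _).trans hm'
  have hε0 : 0 ≤ ε := by rw [hεdef]; positivity
  have hℓ0 : 0 ≤ ℓ := by rw [hℓdef]; positivity
  have hθn : ‖θ‖ ≤ ε := by
    rw [hθdef, norm_div, hnorm, div_le_iff₀ (by positivity)]
    refine hm.trans (le_of_eq ?_)
    rw [hεdef]; field_simp; ring
  have hθ'n : ‖θ'‖ ≤ ℓ := by
    rw [hθ'def, norm_div, hnorm, div_le_iff₀ (by positivity)]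
    refine hm'.trans (le_of_eq ?_)
    rw [hℓdef]; field_simp; ring
  have hθ0 : 0 ≤ ‖θ‖ := norm_nonneg _
  -- the operator identity `S = L − E`
  have hLlet := far_letOperator_eq hG hq u u' κ p m ω
  have hS : (I * ((2 * G / q : ℝ) : ℂ) * (u + (m / (2 * I * ((2 * G / q : ℝ) : ℂ))) * conj u) - (ω : ℂ) * (u' + (m' / (2 * I * ((2 * G / q : ℝ) : ℂ))) * conj u + (m / (2 * I * ((2 * G / q : ℝ) : ℂ))) * conj u') + p * (u + (m / (2 * I * ((2 * G / q : ℝ) : ℂ))) * conj u))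
      = (I * ((2 * G / q : ℝ) : ℂ) * u - (ω : ℂ) * u' + p * u + (2 * I * ((2 * G / q : ℝ) : ℂ) * (m / (2 * I * ((2 * G / q : ℝ) : ℂ)))) * conj u + (-(I * (G : ℂ) * κ)))
        - ((-(I * (G : ℂ) * κ)) + (m / (2 * I * ((2 * G / q : ℝ) : ℂ))) * conj (-(I * (G : ℂ) * κ)) - (m / (2 * I * ((2 * G / q : ℝ) : ℂ))) * conj (I * ((2 * G / q : ℝ) : ℂ) * u - (ω : ℂ) * u' + p * u + (2 * I * ((2 * G / q : ℝ) : ℂ) * (m / (2 * I * ((2 * G / q : ℝ) : ℂ)))) * conj u + (-(I * (G : ℂ) * κ)))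
        + (ω * (m' / (2 * I * ((2 * G / q : ℝ) : ℂ))) + (m / (2 * I * ((2 * G / q : ℝ) : ℂ))) * conj p - p * (m / (2 * I * ((2 * G / q : ℝ) : ℂ)))) * conj u + (m / (2 * I * ((2 * G / q : ℝ) : ℂ))) * conj (2 * I * ((2 * G / q : ℝ) : ℂ) * (m / (2 * I * ((2 * G / q : ℝ) : ℂ)))) * u) :=
    by linear_combination (-1 : ℂ) * hS2
  rw [hS, norm_mul, Complex.norm_conj]
  set y : ℝ := ‖u‖ with hy
  have hy0 : 0 ≤ y := norm_nonneg _
  have hl0 : 0 ≤ ‖L‖ := norm_nonneg _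
  have hr0 : 0 ≤ ‖R‖ := norm_nonneg _
  have hZn : ‖(u + (m / (2 * I * ((2 * G / q : ℝ) : ℂ))) * conj u)‖ ≤ (1 + ε) * y := by
    refine (norm_add_le _ _).trans ?_
    rw [norm_mul, Complex.norm_conj, add_mul, one_mul]
    exact add_le_add le_rfl (mul_le_mul_of_nonneg_right hθn hy0)
  have hwvy : |ω| * y ≤ Λ * ‖(s : ℂ) * u‖ := by
    rw [norm_mul, Complex.norm_real, Real.norm_eq_abs, ← mul_assoc]
    exact mul_le_mul_of_nonneg_right hω hy0
  have hLYn : ‖(I * ((2 * G / q : ℝ) : ℂ) * u - (ω : ℂ) * u' + p * u + (2 * I * ((2 * G / q : ℝ) : ℂ) * (m / (2 * I * ((2 * G / q : ℝ) : ℂ)))) * conj u + (-(I * (G : ℂ) * κ)))‖ = ‖L‖ := by rw [hLlet]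
  -- the error
  have hE : ‖((-(I * (G : ℂ) * κ)) + (m / (2 * I * ((2 * G / q : ℝ) : ℂ))) * conj (-(I * (G : ℂ) * κ)) - (m / (2 * I * ((2 * G / q : ℝ) : ℂ))) * conj (I * ((2 * G / q : ℝ) : ℂ) * u - (ω : ℂ) * u' + p * u + (2 * I * ((2 * G / q : ℝ) : ℂ) * (m / (2 * I * ((2 * G / q : ℝ) : ℂ)))) * conj u + (-(I * (G : ℂ) * κ)))
        + (ω * (m' / (2 * I * ((2 * G / q : ℝ) : ℂ))) + (m / (2 * I * ((2 * G / q : ℝ) : ℂ))) * conj p - p * (m / (2 * I * ((2 * G / q : ℝ) : ℂ)))) * conj u + (m / (2 * I * ((2 * G / q : ℝ) : ℂ))) * conj (2 * I * ((2 * G / q : ℝ) : ℂ) * (m / (2 * I * ((2 * G / q : ℝ) : ℂ)))) * u)‖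
      ≤ (1 + ε) * ‖R‖ + ε * ‖L‖ + ℓ * Λ * ‖(s : ℂ) * u‖ + (2 * b₁ * ε + 2 * (2 * G / q) * ε ^ 2) * y := by
    have ha : ‖θ * conj R‖ ≤ ε * ‖R‖ := by
      rw [norm_mul, Complex.norm_conj]; exact mul_le_mul_of_nonneg_right hθn hr0
    have hb : ‖θ * conj (I * ((2 * G / q : ℝ) : ℂ) * u - (ω : ℂ) * u' + p * u + (2 * I * ((2 * G / q : ℝ) : ℂ) * (m / (2 * I * ((2 * G / q : ℝ) : ℂ)))) * conj u + (-(I * (G : ℂ) * κ)))‖ ≤ ε * ‖L‖ := by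
      rw [norm_mul, Complex.norm_conj, hLYn]; exact mul_le_mul_of_nonneg_right hθn hl0
    have hc : ‖(ω * θ' + θ * conj p - p * θ) * conj u‖ ≤ ℓ * Λ * ‖(s : ℂ) * u‖ + 2 * b₁ * ε * y := by
      rw [norm_mul, Complex.norm_conj]
      have h1' : ‖ω * θ' + θ * conj p - p * θ‖ ≤ |ω| * ℓ + ε * b₁ + b₁ * ε := by
        refine (norm_sub_le _ _).trans (add_le_add ((norm_add_le _ _).trans (add_le_add ?_ ?_)) ?_)
        · rw [norm_mul, Complex.norm_real, Real.norm_eq_abs]; exact mul_le_mul_of_nonneg_left hθ'n (abs_nonneg _)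
        · rw [norm_mul, Complex.norm_conj]; exact mul_le_mul hθn hp (norm_nonneg _) hε0
        · rw [norm_mul]; exact mul_le_mul hp hθn hθ0 hb10
      calc ‖ω * θ' + θ * conj p - p * θ‖ * y ≤ (|ω| * ℓ + ε * b₁ + b₁ * ε) * y := mul_le_mul_of_nonneg_right h1' hy0
        _ = ℓ * (|ω| * y) + 2 * b₁ * ε * y := by ring
        _ ≤ ℓ * (Λ * ‖(s : ℂ) * u‖) + 2 * b₁ * ε * y := add_le_add (mul_le_mul_of_nonneg_left hwvy hℓ0) le_rfl
        _ = ℓ * Λ * ‖(s : ℂ) * u‖ + 2 * b₁ * ε * y := by ring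
    have hd : ‖θ * conj (2 * I * ((2 * G / q : ℝ) : ℂ) * θ) * u‖ ≤ 2 * (2 * G / q) * ε ^ 2 * y := by
      rw [norm_mul, norm_mul, Complex.norm_conj, norm_mul, hnorm]
      have : ‖θ‖ * (2 * (2 * G / q) * ‖θ‖) ≤ ε * (2 * (2 * G / q) * ε) :=
        mul_le_mul hθn (mul_le_mul_of_nonneg_left hθn (by positivity)) (by positivity) hε0
      calc ‖θ‖ * (2 * (2 * G / q) * ‖θ‖) * y ≤ ε * (2 * (2 * G / q) * ε) * y := mul_le_mul_of_nonneg_right this hy0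
        _ = 2 * (2 * G / q) * ε ^ 2 * y := by ring
    calc ‖((-(I * (G : ℂ) * κ)) + (m / (2 * I * ((2 * G / q : ℝ) : ℂ))) * conj (-(I * (G : ℂ) * κ)) - (m / (2 * I * ((2 * G / q : ℝ) : ℂ))) * conj (I * ((2 * G / q : ℝ) : ℂ) * u - (ω : ℂ) * u' + p * u + (2 * I * ((2 * G / q : ℝ) : ℂ) * (m / (2 * I * ((2 * G / q : ℝ) : ℂ)))) * conj u + (-(I * (G : ℂ) * κ)))
        + (ω * (m' / (2 * I * ((2 * G / q : ℝ) : ℂ))) + (m / (2 * I * ((2 * G / q : ℝ) : ℂ))) * conj p - p * (m / (2 * I * ((2 * G / q : ℝ) : ℂ)))) * conj u + (m / (2 * I * ((2 * G / q : ℝ) : ℂ))) * conj (2 * I * ((2 * G / q : ℝ) : ℂ) * (m / (2 * I * ((2 * G / q : ℝ) : ℂ)))) * u)‖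
        ≤ ‖R + θ * conj R - θ * conj (I * ((2 * G / q : ℝ) : ℂ) * u - (ω : ℂ) * u' + p * u + (2 * I * ((2 * G / q : ℝ) : ℂ) * (m / (2 * I * ((2 * G / q : ℝ) : ℂ)))) * conj u + (-(I * (G : ℂ) * κ))) + (ω * θ' + θ * conj p - p * θ) * conj u‖ + ‖θ * conj (2 * I * ((2 * G / q : ℝ) : ℂ) * θ) * u‖ :=
          norm_add_le _ _
      _ ≤ (‖R + θ * conj R - θ * conj (I * ((2 * G / q : ℝ) : ℂ) * u - (ω : ℂ) * u' + p * u + (2 * I * ((2 * G / q : ℝ) : ℂ) * (m / (2 * I * ((2 * G / q : ℝ) : ℂ)))) * conj u + (-(I * (G : ℂ) * κ)))‖ + ‖(ω * θ' + θ * conj p - p * θ) * conj u‖)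
            + ‖θ * conj (2 * I * ((2 * G / q : ℝ) : ℂ) * θ) * u‖ := by
          gcongr; exact norm_add_le _ _
      _ ≤ ((‖R + θ * conj R‖ + ‖θ * conj (I * ((2 * G / q : ℝ) : ℂ) * u - (ω : ℂ) * u' + p * u + (2 * I * ((2 * G / q : ℝ) : ℂ) * (m / (2 * I * ((2 * G / q : ℝ) : ℂ)))) * conj u + (-(I * (G : ℂ) * κ)))‖) + ‖(ω * θ' + θ * conj p - p * θ) * conj u‖)
            + ‖θ * conj (2 * I * ((2 * G / q : ℝ) : ℂ) * θ) * u‖ := by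
          gcongr; exact norm_sub_le _ _
      _ ≤ (((‖R‖ + ε * ‖R‖) + ε * ‖L‖) + (ℓ * Λ * ‖(s : ℂ) * u‖ + 2 * b₁ * ε * y)) + 2 * (2 * G / q) * ε ^ 2 * y := by
          gcongr
          · exact (norm_add_le _ _).trans (add_le_add le_rfl ha)
      _ = (1 + ε) * ‖R‖ + ε * ‖L‖ + ℓ * Λ * ‖(s : ℂ) * u‖ + (2 * b₁ * ε + 2 * (2 * G / q) * ε ^ 2) * y := by ring
  have hc4 : 0 ≤ 2 * b₁ * ε + 2 * (2 * G / q) * ε ^ 2 :=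
    add_nonneg (mul_nonneg (mul_nonneg zero_le_two hb10) hε0) (mul_nonneg (mul_nonneg zero_le_two hGp.le) (sq_nonneg ε))
  have hbig : 0 ≤ ‖L‖ + ((1 + ε) * ‖R‖ + ε * ‖L‖ + ℓ * Λ * ‖(s : ℂ) * u‖ + (2 * b₁ * ε + 2 * (2 * G / q) * ε ^ 2) * y) :=
    add_nonneg hl0 (add_nonneg (add_nonneg (add_nonneg (mul_nonneg (by linarith) hr0) (mul_nonneg hε0 hl0))
      (mul_nonneg (mul_nonneg hℓ0 hΛ) (norm_nonneg _))) (mul_nonneg hc4 hy0))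
  have hSn : ‖(I * ((2 * G / q : ℝ) : ℂ) * u - (ω : ℂ) * u' + p * u + (2 * I * ((2 * G / q : ℝ) : ℂ) * (m / (2 * I * ((2 * G / q : ℝ) : ℂ)))) * conj u + (-(I * (G : ℂ) * κ))) - ((-(I * (G : ℂ) * κ)) + (m / (2 * I * ((2 * G / q : ℝ) : ℂ))) * conj (-(I * (G : ℂ) * κ)) - (m / (2 * I * ((2 * G / q : ℝ) : ℂ))) * conj (I * ((2 * G / q : ℝ) : ℂ) * u - (ω : ℂ) * u' + p * u + (2 * I * ((2 * G / q : ℝ) : ℂ) * (m / (2 * I * ((2 * G / q : ℝ) : ℂ)))) * conj u + (-(I * (G : ℂ) * κ)))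
        + (ω * (m' / (2 * I * ((2 * G / q : ℝ) : ℂ))) + (m / (2 * I * ((2 * G / q : ℝ) : ℂ))) * conj p - p * (m / (2 * I * ((2 * G / q : ℝ) : ℂ)))) * conj u + (m / (2 * I * ((2 * G / q : ℝ) : ℂ))) * conj (2 * I * ((2 * G / q : ℝ) : ℂ) * (m / (2 * I * ((2 * G / q : ℝ) : ℂ)))) * u)‖ ≤ ‖L‖ + ‖((-(I * (G : ℂ) * κ)) + (m / (2 * I * ((2 * G / q : ℝ) : ℂ))) * conj (-(I * (G : ℂ) * κ)) - (m / (2 * I * ((2 * G / q : ℝ) : ℂ))) * conj (I * ((2 * G / q : ℝ) : ℂ) * u - (ω : ℂ) * u' + p * u + (2 * I * ((2 * G / q : ℝ) : ℂ) * (m / (2 * I * ((2 * G / q : ℝ) : ℂ)))) * conj u + (-(I * (G : ℂ) * κ)))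
        + (ω * (m' / (2 * I * ((2 * G / q : ℝ) : ℂ))) + (m / (2 * I * ((2 * G / q : ℝ) : ℂ))) * conj p - p * (m / (2 * I * ((2 * G / q : ℝ) : ℂ)))) * conj u + (m / (2 * I * ((2 * G / q : ℝ) : ℂ))) * conj (2 * I * ((2 * G / q : ℝ) : ℂ) * (m / (2 * I * ((2 * G / q : ℝ) : ℂ)))) * u)‖ := (norm_sub_le _ _).trans (by rw [hLYn])
  calc ‖(I * ((2 * G / q : ℝ) : ℂ) * u - (ω : ℂ) * u' + p * u + (2 * I * ((2 * G / q : ℝ) : ℂ) * (m / (2 * I * ((2 * G / q : ℝ) : ℂ)))) * conj u + (-(I * (G : ℂ) * κ))) - ((-(I * (G : ℂ) * κ)) + (m / (2 * I * ((2 * G / q : ℝ) : ℂ))) * conj (-(I * (G : ℂ) * κ)) - (m / (2 * I * ((2 * G / q : ℝ) : ℂ))) * conj (I * ((2 * G / q : ℝ) : ℂ) * u - (ω : ℂ) * u' + p * u + (2 * I * ((2 * G / q : ℝ) : ℂ) * (m / (2 * I * ((2 * G / q : ℝ) : ℂ)))) * conj u + (-(I * (G : ℂ) * κ)))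
        + (ω * (m' / (2 * I * ((2 * G / q : ℝ) : ℂ))) + (m / (2 * I * ((2 * G / q : ℝ) : ℂ))) * conj p - p * (m / (2 * I * ((2 * G / q : ℝ) : ℂ)))) * conj u + (m / (2 * I * ((2 * G / q : ℝ) : ℂ))) * conj (2 * I * ((2 * G / q : ℝ) : ℂ) * (m / (2 * I * ((2 * G / q : ℝ) : ℂ)))) * u)‖ * ‖(u + (m / (2 * I * ((2 * G / q : ℝ) : ℂ))) * conj u)‖
      ≤ (‖L‖ + ((1 + ε) * ‖R‖ + ε * ‖L‖ + ℓ * Λ * ‖(s : ℂ) * u‖ + (2 * b₁ * ε + 2 * (2 * G / q) * ε ^ 2) * y)) * ((1 + ε) * y) :=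
        mul_le_mul (hSn.trans (add_le_add le_rfl hE)) hZn (norm_nonneg _) hbig
    _ = (1 + ε) * (y * ((1 + ε) * ‖L‖ + (1 + ε) * ‖R‖ + ℓ * Λ * ‖(s : ℂ) * u‖ + (2 * b₁ * ε + 2 * (2 * G / q) * ε ^ 2) * y)) := by
        ring

/-! ## §2 Integrating the pointwise bound -/

/-- Cauchy–Schwarz bookkeeping: a pointwise bound `‖F‖ ≤ a‖f‖(a‖g‖ + a‖h‖ + c₃‖v‖ + c₄‖f‖)` by `L²` functions integrates to
`∫‖F‖ ≤ a(a·N(f)N(g) + a·N(f)N(h) + c₃N(f)N(v) + c₄N(f)²)`, `N = (∫‖·‖²)^{1/2}`. [folklore] -/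
theorem integral_le_of_pointwise_far {f g h v F : ℝ → ℂ} (hf : MemLp f 2 volume) (hg : MemLp g 2 volume) (hh : MemLp h 2 volume)
    (hv : MemLp v 2 volume) {a c₃ c₄ : ℝ} (ha : 0 ≤ a) (hc₃ : 0 ≤ c₃) (hc₄ : 0 ≤ c₄)
    (hpt : ∀ τ, ‖F τ‖ ≤ a * (‖f τ‖ * (a * ‖g τ‖ + a * ‖h τ‖ + c₃ * ‖v τ‖ + c₄ * ‖f τ‖))) :
    ∫ τ, ‖F τ‖ ≤ a * (a * ((∫ τ, ‖f τ‖ ^ 2) ^ (1 / 2 : ℝ) * (∫ τ, ‖g τ‖ ^ 2) ^ (1 / 2 : ℝ))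
        + a * ((∫ τ, ‖f τ‖ ^ 2) ^ (1 / 2 : ℝ) * (∫ τ, ‖h τ‖ ^ 2) ^ (1 / 2 : ℝ))
        + c₃ * ((∫ τ, ‖f τ‖ ^ 2) ^ (1 / 2 : ℝ) * (∫ τ, ‖v τ‖ ^ 2) ^ (1 / 2 : ℝ))
        + c₄ * ((∫ τ, ‖f τ‖ ^ 2) ^ (1 / 2 : ℝ) * (∫ τ, ‖f τ‖ ^ 2) ^ (1 / 2 : ℝ))) := by
  have hIg : Integrable fun τ : ℝ => ‖f τ‖ * ‖g τ‖ := hf.norm.integrable_mul hg.norm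
  have hIh : Integrable fun τ : ℝ => ‖f τ‖ * ‖h τ‖ := hf.norm.integrable_mul hh.norm
  have hIv : Integrable fun τ : ℝ => ‖f τ‖ * ‖v τ‖ := hf.norm.integrable_mul hv.norm
  have hIf : Integrable fun τ : ℝ => ‖f τ‖ * ‖f τ‖ := hf.norm.integrable_mul hf.norm
  have hA : Integrable fun τ : ℝ => a * (‖f τ‖ * ‖g τ‖) := hIg.const_mul _
  have hB : Integrable fun τ : ℝ => a * (‖f τ‖ * ‖h τ‖) := hIh.const_mul _
  have hC : Integrable fun τ : ℝ => c₃ * (‖f τ‖ * ‖v τ‖) := hIv.const_mul _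
  have hD : Integrable fun τ : ℝ => c₄ * (‖f τ‖ * ‖f τ‖) := hIf.const_mul _
  have hAB : Integrable fun τ : ℝ => a * (‖f τ‖ * ‖g τ‖) + a * (‖f τ‖ * ‖h τ‖) := hA.add hB
  have hABC : Integrable fun τ : ℝ => a * (‖f τ‖ * ‖g τ‖) + a * (‖f τ‖ * ‖h τ‖) + c₃ * (‖f τ‖ * ‖v τ‖) := hAB.add hC
  have hall : Integrable fun τ : ℝ => a * (‖f τ‖ * ‖g τ‖) + a * (‖f τ‖ * ‖h τ‖) + c₃ * (‖f τ‖ * ‖v τ‖) + c₄ * (‖f τ‖ * ‖f τ‖) :=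
    hABC.add hD
  have hup : Integrable fun τ : ℝ => a * (‖f τ‖ * (a * ‖g τ‖ + a * ‖h τ‖ + c₃ * ‖v τ‖ + c₄ * ‖f τ‖)) := by
    refine (hall.const_mul a).congr (ae_of_all _ fun τ => ?_)
    ring
  refine (integral_mono_of_nonneg (ae_of_all _ fun τ => norm_nonneg _) hup (ae_of_all _ hpt)).trans ?_
  have e : (∫ τ : ℝ, a * (‖f τ‖ * (a * ‖g τ‖ + a * ‖h τ‖ + c₃ * ‖v τ‖ + c₄ * ‖f τ‖)))
      = ∫ τ : ℝ, a * (a * (‖f τ‖ * ‖g τ‖) + a * (‖f τ‖ * ‖h τ‖) + c₃ * (‖f τ‖ * ‖v τ‖) + c₄ * (‖f τ‖ * ‖f τ‖)) :=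
    integral_congr_ae (ae_of_all _ fun τ => by ring)
  rw [e, integral_const_mul, integral_add hABC hD, integral_add hAB hC, integral_add hA hB,
    integral_const_mul, integral_const_mul, integral_const_mul, integral_const_mul]
  have h1 := integral_norm_mul_norm_le hf hg
  have h2 := integral_norm_mul_norm_le hf hh
  have h3 := integral_norm_mul_norm_le hf hv
  have h4 := integral_norm_mul_norm_le hf hf
  gcongr

/-! ## §3 The far piece estimate -/

/-- **FAR PIECE ESTIMATE.**  `q, G, X > 0`, `0 ≤ β₀`; near kernel `k` real, continuous, bounded, `k, t k ∈ L¹`, profile `χ(z) = ∫k e^{izt}` with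
`χ = 1` on `|z|√q < X`; `Y ∈ C¹_c`; `w` differentiable, `w(c) = 0`, `|w′| ≤ Λ`; `β₁` continuous, `‖β₁‖ ≤ b₁`; `β₂ ∈ C¹`, `‖β₂‖ ≤ b₂`, `‖β₂′‖ ≤ L₂`;
`ε := b₂q/(4G) ≤ 1`; growth `β₀ ≤ ½w′ + Re β₁`.  With `Y_H = Y − k∗Y`, `η = (2/q)5e^{−X/2}`, `ℓ = L₂q/(4G)`, `G′ = 2G/q`, `N(f) = (∫‖f‖²)^{1/2}`:
`β₀(1−ε)²∫‖Y_H‖² ≤ (1+ε)N(Y_H)·((1+ε)N(𝓛Y_H) + ((1+ε)Gη + 2b₁ε + 2G′ε²)N(Y_H) + ℓΛ·N((τ−c)Y_H))`. [folklore] -/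
theorem model_piece_far_estimate {q G X β₀ : ℝ} (hq : 0 < q) (hG : 0 < G) (hX : 0 < X) (hβ₀ : 0 ≤ β₀)
    {k : ℝ → ℝ} (hkc : Continuous k) (hki : Integrable k) (hk1 : Integrable fun t => t * k t) {Mk : ℝ} (hkM : ∀ t, |k t| ≤ Mk)
    {χ : ℝ → ℂ} (hkχ : ∀ z : ℝ, ∫ t : ℝ, ((k t : ℝ) : ℂ) * cexp (I * z * t) = χ z) (hfar : ∀ z : ℝ, χ z ≠ 1 → X ≤ |z| * √q)
    {Y : ℝ → ℂ} (hY : ContDiff ℝ 1 Y) (hYs : HasCompactSupport Y) (c : ℝ)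
    {w : ℝ → ℝ} (hw : Differentiable ℝ w) {Λ : ℝ} (hΛ : ∀ t, |deriv w t| ≤ Λ) (hwc : w c = 0)
    {β₁ β₂ β₂' : ℝ → ℂ} (hβ₁c : Continuous β₁) (hβ₂ : ∀ τ, HasDerivAt β₂ (β₂' τ) τ) (hβ₂'c : Continuous β₂')
    {b₁ b₂ L₂ : ℝ} (hb₁ : ∀ τ, ‖β₁ τ‖ ≤ b₁) (hb₂ : ∀ τ, ‖β₂ τ‖ ≤ b₂) (hL₂ : ∀ τ, ‖β₂' τ‖ ≤ L₂)
    (hε : b₂ * q / (4 * G) ≤ 1) (hgrowth : ∀ τ, β₀ ≤ 1 / 2 * deriv w τ + (β₁ τ).re) :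
    β₀ * (1 - (b₂ * q / (4 * G))) ^ 2 * ∫ x : ℝ, ‖(Y x - ∫ y : ℝ, ((k (x - y) : ℝ) : ℂ) * Y y)‖ ^ 2
      ≤ (1 + (b₂ * q / (4 * G))) * (∫ x : ℝ, ‖(Y x - ∫ y : ℝ, ((k (x - y) : ℝ) : ℂ) * Y y)‖ ^ 2) ^ (1 / 2 : ℝ)
        * ((1 + (b₂ * q / (4 * G))) * (∫ x : ℝ, ‖I * (G : ℂ) * ((2 / q : ℂ) * (Y x - ∫ y : ℝ, ((k (x - y) : ℝ) : ℂ) * Y y)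
          - ∫ σ : ℝ, ((((2 * q - (x - σ) ^ 2) * (((x - σ) ^ 2 + q) ^ (5 / 2 : ℝ))⁻¹ : ℝ)) : ℂ) * (Y σ - ∫ y : ℝ, ((k (σ - y) : ℝ) : ℂ) * Y y))
        - ((w x : ℝ) : ℂ) * (deriv Y x - ∫ y : ℝ, ((k (x - y) : ℝ) : ℂ) * deriv Y y) + β₁ x * (Y x - ∫ y : ℝ, ((k (x - y) : ℝ) : ℂ) * Y y) + β₂ x * conj (Y x - ∫ y : ℝ, ((k (x - y) : ℝ) : ℂ) * Y y)‖ ^ 2) ^ (1 / 2 : ℝ)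
          + ((1 + (b₂ * q / (4 * G))) * G * (2 / q * (5 * Real.exp (-(X / 2)))) + 2 * b₁ * (b₂ * q / (4 * G)) + 2 * (2 * G / q) * (b₂ * q / (4 * G)) ^ 2)
            * (∫ x : ℝ, ‖(Y x - ∫ y : ℝ, ((k (x - y) : ℝ) : ℂ) * Y y)‖ ^ 2) ^ (1 / 2 : ℝ)
          + (L₂ * q / (4 * G)) * Λ * (∫ x : ℝ, ‖((x - c : ℝ) : ℂ) * (Y x - ∫ y : ℝ, ((k (x - y) : ℝ) : ℂ) * Y y)‖ ^ 2) ^ (1 / 2 : ℝ)) := by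
  have hYc := hY.continuous
  have hY'c : Continuous (deriv Y) := hY.continuous_deriv le_rfl
  have hYd : ∀ x, HasDerivAt Y (deriv Y x) x := fun x => (hY.differentiable one_ne_zero x).hasDerivAt
  have hYi : Integrable Y := hYc.integrable_of_hasCompactSupport hYs
  have hΛ0 : 0 ≤ Λ := (abs_nonneg _).trans (hΛ 0)
  have hb10 : 0 ≤ b₁ := (norm_nonneg _).trans (hb₁ 0)
  have hb20 : 0 ≤ b₂ := (norm_nonneg _).trans (hb₂ 0)
  have hL20 : 0 ≤ L₂ := (norm_nonneg _).trans (hL₂ 0)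
  have hGp : 0 < (2 * G / q) := by positivity
  have hε0 : 0 ≤ (b₂ * q / (4 * G)) := by positivity
  have hβ₂c : Continuous β₂ := continuous_iff_continuousAt.2 fun t => (hβ₂ t).continuousAt
  -- the near piece and the far piece
  have hPd : ∀ x : ℝ, HasDerivAt (fun x : ℝ => ∫ y : ℝ, ((k (x - y) : ℝ) : ℂ) * Y y) (∫ y : ℝ, ((k (x - y) : ℝ) : ℂ) * deriv Y y) x := hasDerivAt_piece hkc hY hYs
  have hPc : Continuous fun x : ℝ => ∫ y : ℝ, ((k (x - y) : ℝ) : ℂ) * Y y := continuous_piece hkc hYc hYs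
  have hP'c : Continuous fun x : ℝ => ∫ y : ℝ, ((k (x - y) : ℝ) : ℂ) * deriv Y y := continuous_piece hkc hY'c hYs.deriv
  have hP1 : Integrable fun x : ℝ => ∫ y : ℝ, ((k (x - y) : ℝ) : ℂ) * Y y := integrable_piece hki hYc hYs
  have hP2 : MemLp (fun x : ℝ => ∫ y : ℝ, ((k (x - y) : ℝ) : ℂ) * Y y) 2 volume := memLp_piece hkc hki hYc hYs
  have hwP2 := memLp_weight_piece hkc hki hk1 hYc hYs c
  have hwP'2 := memLp_weight_piece hkc hki hk1 hY'c hYs.deriv c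
  have hY2 : MemLp Y 2 volume := hYc.memLp_of_hasCompactSupport hYs
  have hwYc : Continuous fun x : ℝ => ((x - c : ℝ) : ℂ) * Y x := (Complex.continuous_ofReal.comp (continuous_id.sub continuous_const)).mul hYc
  have hwY'c : Continuous fun x : ℝ => ((x - c : ℝ) : ℂ) * deriv Y x :=
    (Complex.continuous_ofReal.comp (continuous_id.sub continuous_const)).mul hY'c
  have hwY2 : MemLp (fun x : ℝ => ((x - c : ℝ) : ℂ) * Y x) 2 volume := hwYc.memLp_of_hasCompactSupport hYs.mul_left
  have hwY'2 : MemLp (fun x : ℝ => ((x - c : ℝ) : ℂ) * deriv Y x) 2 volume := hwY'c.memLp_of_hasCompactSupport hYs.deriv.mul_left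
  have hYHd : ∀ τ : ℝ, HasDerivAt (fun x : ℝ => (Y x - ∫ y : ℝ, ((k (x - y) : ℝ) : ℂ) * Y y)) (deriv Y τ - ∫ y : ℝ, ((k (τ - y) : ℝ) : ℂ) * deriv Y y) τ := fun τ => (hYd τ).sub (hPd τ)
  have hYHc : Continuous fun x : ℝ => (Y x - ∫ y : ℝ, ((k (x - y) : ℝ) : ℂ) * Y y) := hYc.sub hPc
  have hYH'c : Continuous fun τ : ℝ => (deriv Y τ - ∫ y : ℝ, ((k (τ - y) : ℝ) : ℂ) * deriv Y y) := hY'c.sub hP'c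
  have hYH1 : Integrable fun x : ℝ => (Y x - ∫ y : ℝ, ((k (x - y) : ℝ) : ℂ) * Y y) := hYi.sub hP1
  have hYH2 : MemLp (fun x : ℝ => (Y x - ∫ y : ℝ, ((k (x - y) : ℝ) : ℂ) * Y y)) 2 volume := hY2.sub hP2
  have hwYH2 : MemLp (fun x : ℝ => ((x - c : ℝ) : ℂ) * (Y x - ∫ y : ℝ, ((k (x - y) : ℝ) : ℂ) * Y y)) 2 volume := by
    refine (hwY2.sub hwP2).ae_eq (ae_of_all _ fun x => ?_)
    simp only [Pi.sub_apply]; ring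
  have hwYH'2 : MemLp (fun x : ℝ => ((x - c : ℝ) : ℂ) * (deriv Y x - ∫ y : ℝ, ((k (x - y) : ℝ) : ℂ) * deriv Y y)) 2 volume := by
    refine (hwY'2.sub hwP'2).ae_eq (ae_of_all _ fun x => ?_)
    simp only [Pi.sub_apply]; ring
  -- `Y_H` is bounded
  obtain ⟨MY, hMY⟩ := hYc.bounded_above_of_compact_support hYs
  have hYHb : ∀ x : ℝ, ‖(Y x - ∫ y : ℝ, ((k (x - y) : ℝ) : ℂ) * Y y)‖ ≤ MY + Mk * ∫ y : ℝ, ‖Y y‖ := by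
    intro x
    refine (norm_sub_le _ _).trans (add_le_add (hMY x) ((norm_piece_le hkc hYc hYs x).trans ?_))
    rw [← integral_const_mul]
    refine integral_mono_of_nonneg (ae_of_all _ fun y => by positivity) (hYi.norm.const_mul _) (ae_of_all _ fun y => ?_)
    exact mul_le_mul_of_nonneg_right (hkM _) (norm_nonneg _)
  -- spectral support of `Y_H`
  have hsuppH : ∀ z : ℝ, |z| * √q < X → ∫ x : ℝ, (Y x - ∫ y : ℝ, ((k (x - y) : ℝ) : ℂ) * Y y) * cexp (I * z * x) = 0 := by
    intro z hz
    have hχ1 : χ z = 1 := by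
      by_contra hne
      have := hfar z hne
      linarith
    have he : ∀ x : ℝ, ‖cexp (I * z * x)‖ ≤ 1 := fun x => by
      rw [show I * (z : ℂ) * (x : ℂ) = ((z * x : ℝ) : ℂ) * I by push_cast; ring, Complex.norm_exp_ofReal_mul_I]
    have hem : AEStronglyMeasurable (fun x : ℝ => cexp (I * z * x)) volume :=
      (Complex.continuous_exp.comp (continuous_const.mul Complex.continuous_ofReal)).aestronglyMeasurable
    have hI1 : Integrable fun x : ℝ => Y x * cexp (I * z * x) := hYi.mul_bdd hem (ae_of_all _ he)
    have hI2 : Integrable fun x : ℝ => (∫ y : ℝ, ((k (x - y) : ℝ) : ℂ) * Y y) * cexp (I * z * x) := hP1.mul_bdd hem (ae_of_all _ he)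
    have hconv := unnormalisedTransform_conv (k := fun t => ((k t : ℝ) : ℂ)) hki.ofReal hYi z
    beta_reduce at hconv
    simp_rw [sub_mul]
    rw [integral_sub hI1 hI2, hconv, hkχ z, hχ1, one_mul, sub_self]
  -- the smoothing remainder
  obtain ⟨hKH2, hKHle⟩ := integral_sq_norm_smoothingPiece_far_le hq hX hYHc hYH1 hYH2 hYHb hsuppH
  -- `θ = β₂/(2iG′)`
  have hnorm : ‖(2 * I * ((2 * G / q : ℝ) : ℂ))‖ = 2 * (2 * G / q) := by
    rw [norm_mul, norm_mul, Complex.norm_two, Complex.norm_I, mul_one, Complex.norm_real, Real.norm_of_nonneg hGp.le]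
  have hθd : ∀ τ : ℝ, HasDerivAt (fun τ : ℝ => (β₂ τ / (2 * I * ((2 * G / q : ℝ) : ℂ)))) (β₂' τ / (2 * I * ((2 * G / q : ℝ) : ℂ))) τ := fun τ => (hβ₂ τ).div_const _
  have hθ'c : Continuous fun τ : ℝ => (β₂' τ / (2 * I * ((2 * G / q : ℝ) : ℂ))) := hβ₂'c.div_const _
  have hθc : Continuous fun τ : ℝ => (β₂ τ / (2 * I * ((2 * G / q : ℝ) : ℂ))) := hβ₂c.div_const _
  have hθε : ∀ τ : ℝ, ‖(β₂ τ / (2 * I * ((2 * G / q : ℝ) : ℂ)))‖ ≤ (b₂ * q / (4 * G)) := by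
    intro τ
    rw [norm_div, hnorm, div_le_iff₀ (by positivity)]
    refine (hb₂ τ).trans (le_of_eq ?_)
    field_simp
    ring
  have hθ'ℓ : ∀ τ : ℝ, ‖(β₂' τ / (2 * I * ((2 * G / q : ℝ) : ℂ)))‖ ≤ (L₂ * q / (4 * G)) := by
    intro τ
    rw [norm_div, hnorm, div_le_iff₀ (by positivity)]
    refine (hL₂ τ).trans (le_of_eq ?_)
    field_simp
    ring
  -- the far-branch energy estimate
  have hfb := model_farBranch_energy (G' := (2 * G / q)) hYHd hYH'c hθd hθ'c hθε hθ'ℓ hYH2 hwYH2 hwYH'2 hw hΛ hwc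
    hβ₁c.aestronglyMeasurable hb₁ hgrowth (fun τ : ℝ => (-(I * (G : ℂ) * ∫ σ : ℝ, ((((2 * q - (τ - σ) ^ 2) * (((τ - σ) ^ 2 + q) ^ (5 / 2 : ℝ))⁻¹ : ℝ)) : ℂ) * (Y σ - ∫ y : ℝ, ((k (σ - y) : ℝ) : ℂ) * Y y))))
  obtain ⟨h1, h2, h3⟩ := hfb
  beta_reduce at h1 h2 h3
  -- `L²` facts: `𝓛Y_H`, `Rm`, `Z`
  have hL2 : MemLp (fun τ : ℝ => I * (G : ℂ) * ((2 / q : ℂ) * (Y τ - ∫ y : ℝ, ((k (τ - y) : ℝ) : ℂ) * Y y)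
          - ∫ σ : ℝ, ((((2 * q - (τ - σ) ^ 2) * (((τ - σ) ^ 2 + q) ^ (5 / 2 : ℝ))⁻¹ : ℝ)) : ℂ) * (Y σ - ∫ y : ℝ, ((k (σ - y) : ℝ) : ℂ) * Y y))
        - ((w τ : ℝ) : ℂ) * (deriv Y τ - ∫ y : ℝ, ((k (τ - y) : ℝ) : ℂ) * deriv Y y) + β₁ τ * (Y τ - ∫ y : ℝ, ((k (τ - y) : ℝ) : ℂ) * Y y) + β₂ τ * conj (Y τ - ∫ y : ℝ, ((k (τ - y) : ℝ) : ℂ) * Y y)) 2 volume := by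
    have hT := memLp_slip_mul hYH'c.aestronglyMeasurable hwYH'2 hw hΛ hwc
    have hsum := ((((hYH2.const_mul (I * (G : ℂ) * (2 / q : ℂ))).sub (hKH2.const_mul (I * (G : ℂ)))).sub hT).add
      (memLp_boundedMultiplier_mul hβ₁c.aestronglyMeasurable hb₁ hYH2)).add
      (memLp_boundedMultiplier_mul hβ₂c.aestronglyMeasurable hb₂ (memLp_conj hYH2))
    refine hsum.ae_eq (ae_of_all _ fun τ => ?_)
    simp only [Pi.add_apply, Pi.sub_apply]
    ring
  have hRm2 : MemLp (fun τ : ℝ => (-(I * (G : ℂ) * ∫ σ : ℝ, ((((2 * q - (τ - σ) ^ 2) * (((τ - σ) ^ 2 + q) ^ (5 / 2 : ℝ))⁻¹ : ℝ)) : ℂ) * (Y σ - ∫ y : ℝ, ((k (σ - y) : ℝ) : ℂ) * Y y)))) 2 volume := (hKH2.const_mul (I * (G : ℂ))).neg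
  have hZ2 : MemLp (fun τ : ℝ => ((Y τ - ∫ y : ℝ, ((k (τ - y) : ℝ) : ℂ) * Y y) + (β₂ τ / (2 * I * ((2 * G / q : ℝ) : ℂ))) * conj (Y τ - ∫ y : ℝ, ((k (τ - y) : ℝ) : ℂ) * Y y))) 2 volume :=
    hYH2.add (memLp_boundedMultiplier_mul hθc.aestronglyMeasurable hθε (memLp_conj hYH2))
  -- pointwise bound on the energy integrand and its integral
  have hslip : ∀ τ, |w τ| ≤ Λ * |τ - c| := abs_slip_le hw hΛ hwc
  have hpt : ∀ τ : ℝ, ‖(I * ((2 * G / q : ℝ) : ℂ) * ((Y τ - ∫ y : ℝ, ((k (τ - y) : ℝ) : ℂ) * Y y) + (β₂ τ / (2 * I * ((2 * G / q : ℝ) : ℂ))) * conj (Y τ - ∫ y : ℝ, ((k (τ - y) : ℝ) : ℂ) * Y y)) - ((w τ : ℝ) : ℂ) * ((deriv Y τ - ∫ y : ℝ, ((k (τ - y) : ℝ) : ℂ) * deriv Y y) + (β₂' τ / (2 * I * ((2 * G / q : ℝ) : ℂ))) * conj (Y τ - ∫ y : ℝ, ((k (τ - y) : ℝ) : ℂ)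 * Y y) + (β₂ τ / (2 * I * ((2 * G / q : ℝ) : ℂ))) * conj (deriv Y τ - ∫ y : ℝ, ((k (τ - y) : ℝ) : ℂ) * deriv Y y)) + β₁ τ * ((Y τ - ∫ y : ℝ, ((k (τ - y) : ℝ) : ℂ) * Y y) + (β₂ τ / (2 * I * ((2 * G / q : ℝ) : ℂ))) * conj (Y τ - ∫ y : ℝ, ((k (τ - y) : ℝ) : ℂ) * Y y))) * conj ((Y τ - ∫ y : ℝ, ((k (τ - y) : ℝ) : ℂ) * Y y) + (β₂ τ / (2 * I * ((2 * G / q : ℝ) : ℂ))) * conj (Y τ - ∫ y : ℝ, ((k (τ - y) : ℝ) : ℂ) * Y y))‖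
      ≤ (1 + (b₂ * q / (4 * G))) * (‖(Y τ - ∫ y : ℝ, ((k (τ - y) : ℝ) : ℂ) * Y y)‖
        * ((1 + (b₂ * q / (4 * G))) * ‖I * (G : ℂ) * ((2 / q : ℂ) * (Y τ - ∫ y : ℝ, ((k (τ - y) : ℝ) : ℂ) * Y y)
          - ∫ σ : ℝ, ((((2 * q - (τ - σ) ^ 2) * (((τ - σ) ^ 2 + q) ^ (5 / 2 : ℝ))⁻¹ : ℝ)) : ℂ) * (Y σ - ∫ y : ℝ, ((k (σ - y) : ℝ) : ℂ) * Y y))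
        - ((w τ : ℝ) : ℂ) * (deriv Y τ - ∫ y : ℝ, ((k (τ - y) : ℝ) : ℂ) * deriv Y y) + β₁ τ * (Y τ - ∫ y : ℝ, ((k (τ - y) : ℝ) : ℂ) * Y y) + β₂ τ * conj (Y τ - ∫ y : ℝ, ((k (τ - y) : ℝ) : ℂ) * Y y)‖
          + (1 + (b₂ * q / (4 * G))) * ‖(-(I * (G : ℂ) * ∫ σ : ℝ, ((((2 * q - (τ - σ) ^ 2) * (((τ - σ) ^ 2 + q) ^ (5 / 2 : ℝ))⁻¹ : ℝ)) : ℂ) * (Y σ - ∫ y : ℝ, ((k (σ - y) : ℝ) : ℂ) * Y y)))‖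
          + (L₂ * q / (4 * G)) * Λ * ‖((τ - c : ℝ) : ℂ) * (Y τ - ∫ y : ℝ, ((k (τ - y) : ℝ) : ℂ) * Y y)‖
          + (2 * b₁ * (b₂ * q / (4 * G)) + 2 * (2 * G / q) * (b₂ * q / (4 * G)) ^ 2) * ‖(Y τ - ∫ y : ℝ, ((k (τ - y) : ℝ) : ℂ) * Y y)‖)) :=
    fun τ => far_pointwise_bound hG hq hΛ0 (hslip τ) (hb₁ τ) (hb₂ τ) (hL₂ τ) (h2 τ)
  have hint := integral_le_of_pointwise_far hYH2 hL2 hRm2 hwYH2 (by positivity : (0 : ℝ) ≤ 1 + (b₂ * q / (4 * G)))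
    (by positivity : (0 : ℝ) ≤ (L₂ * q / (4 * G)) * Λ) (by positivity : (0 : ℝ) ≤ (2 * b₁ * (b₂ * q / (4 * G)) + 2 * (2 * G / q) * (b₂ * q / (4 * G)) ^ 2)) hpt
  have hmain := h1.trans ((Complex.re_le_norm _).trans ((norm_integral_le_integral_norm _).trans hint))
  -- lower bound `(1−ε)²∫‖Y_H‖² ≤ ∫‖Z‖²`
  have hlow : (1 - (b₂ * q / (4 * G))) ^ 2 * ∫ x : ℝ, ‖(Y x - ∫ y : ℝ, ((k (x - y) : ℝ) : ℂ) * Y y)‖ ^ 2 ≤ ∫ τ : ℝ, ‖((Y τ - ∫ y : ℝ, ((k (τ - y) : ℝ) : ℂ) * Y y) + (β₂ τ / (2 * I * ((2 * G / q : ℝ) : ℂ))) * conj (Y τ - ∫ y : ℝ, ((k (τ - y) : ℝ) : ℂ) * Y y))‖ ^ 2 := by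
    rw [← integral_const_mul]
    refine integral_mono_of_nonneg (ae_of_all _ fun τ => by positivity) ((memLp_two_iff_integrable_sq_norm hZ2.1).1 hZ2)
      (ae_of_all _ fun τ => ?_)
    calc (1 - (b₂ * q / (4 * G))) ^ 2 * ‖(Y τ - ∫ y : ℝ, ((k (τ - y) : ℝ) : ℂ) * Y y)‖ ^ 2
        = ((1 - (b₂ * q / (4 * G))) * ‖(Y τ - ∫ y : ℝ, ((k (τ - y) : ℝ) : ℂ) * Y y)‖) ^ 2 := (mul_pow _ _ 2).symm
      _ ≤ _ := pow_le_pow_left₀ (mul_nonneg (by linarith) (norm_nonneg _)) (h3 τ).1 2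
  -- `N(Rm) ≤ Gη·N(Y_H)`
  have hRmle : (∫ τ : ℝ, ‖(-(I * (G : ℂ) * ∫ σ : ℝ, ((((2 * q - (τ - σ) ^ 2) * (((τ - σ) ^ 2 + q) ^ (5 / 2 : ℝ))⁻¹ : ℝ)) : ℂ) * (Y σ - ∫ y : ℝ, ((k (σ - y) : ℝ) : ℂ) * Y y)))‖ ^ 2) ^ (1 / 2 : ℝ) ≤ G * (2 / q * (5 * Real.exp (-(X / 2)))) * (∫ x : ℝ, ‖(Y x - ∫ y : ℝ, ((k (x - y) : ℝ) : ℂ) * Y y)‖ ^ 2) ^ (1 / 2 : ℝ) := by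
    refine l2_le_of_sq_le (by positivity) ?_
    have e : ∫ τ : ℝ, ‖(-(I * (G : ℂ) * ∫ σ : ℝ, ((((2 * q - (τ - σ) ^ 2) * (((τ - σ) ^ 2 + q) ^ (5 / 2 : ℝ))⁻¹ : ℝ)) : ℂ) * (Y σ - ∫ y : ℝ, ((k (σ - y) : ℝ) : ℂ) * Y y)))‖ ^ 2 = G ^ 2 * ∫ τ : ℝ, ‖∫ σ : ℝ, ((((2 * q - (τ - σ) ^ 2) * (((τ - σ) ^ 2 + q) ^ (5 / 2 : ℝ))⁻¹ : ℝ)) : ℂ) * (Y σ - ∫ y : ℝ, ((k (σ - y) : ℝ) : ℂ) * Y y)‖ ^ 2 := by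
      rw [← integral_const_mul]
      refine integral_congr_ae (ae_of_all _ fun τ => ?_)
      simp only [norm_neg, norm_mul, Complex.norm_I, Complex.norm_real, Real.norm_of_nonneg hG.le, one_mul, mul_pow]
    rw [e, mul_pow, mul_assoc]
    exact mul_le_mul_of_nonneg_left hKHle (by positivity)
  -- assemble
  have hNY0 : 0 ≤ (∫ x : ℝ, ‖(Y x - ∫ y : ℝ, ((k (x - y) : ℝ) : ℂ) * Y y)‖ ^ 2) ^ (1 / 2 : ℝ) := by positivity
  set nY : ℝ := (∫ x : ℝ, ‖(Y x - ∫ y : ℝ, ((k (x - y) : ℝ) : ℂ) * Y y)‖ ^ 2) ^ (1 / 2 : ℝ) with hnY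
  set nL : ℝ := (∫ x : ℝ, ‖I * (G : ℂ) * ((2 / q : ℂ) * (Y x - ∫ y : ℝ, ((k (x - y) : ℝ) : ℂ) * Y y)
          - ∫ σ : ℝ, ((((2 * q - (x - σ) ^ 2) * (((x - σ) ^ 2 + q) ^ (5 / 2 : ℝ))⁻¹ : ℝ)) : ℂ) * (Y σ - ∫ y : ℝ, ((k (σ - y) : ℝ) : ℂ) * Y y))
        - ((w x : ℝ) : ℂ) * (deriv Y x - ∫ y : ℝ, ((k (x - y) : ℝ) : ℂ) * deriv Y y) + β₁ x * (Y x - ∫ y : ℝ, ((k (x - y) : ℝ) : ℂ) * Y y) + β₂ x * conj (Y x - ∫ y : ℝ, ((k (x - y) : ℝ) : ℂ) * Y y)‖ ^ 2) ^ (1 / 2 : ℝ) with hnL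
  set nW : ℝ := (∫ x : ℝ, ‖((x - c : ℝ) : ℂ) * (Y x - ∫ y : ℝ, ((k (x - y) : ℝ) : ℂ) * Y y)‖ ^ 2) ^ (1 / 2 : ℝ) with hnW
  set nR : ℝ := (∫ τ : ℝ, ‖(-(I * (G : ℂ) * ∫ σ : ℝ, ((((2 * q - (τ - σ) ^ 2) * (((τ - σ) ^ 2 + q) ^ (5 / 2 : ℝ))⁻¹ : ℝ)) : ℂ) * (Y σ - ∫ y : ℝ, ((k (σ - y) : ℝ) : ℂ) * Y y)))‖ ^ 2) ^ (1 / 2 : ℝ) with hnR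
  calc β₀ * (1 - (b₂ * q / (4 * G))) ^ 2 * ∫ x : ℝ, ‖(Y x - ∫ y : ℝ, ((k (x - y) : ℝ) : ℂ) * Y y)‖ ^ 2
      = β₀ * ((1 - (b₂ * q / (4 * G))) ^ 2 * ∫ x : ℝ, ‖(Y x - ∫ y : ℝ, ((k (x - y) : ℝ) : ℂ) * Y y)‖ ^ 2) := by ring
    _ ≤ β₀ * ∫ τ : ℝ, ‖((Y τ - ∫ y : ℝ, ((k (τ - y) : ℝ) : ℂ) * Y y) + (β₂ τ / (2 * I * ((2 * G / q : ℝ) : ℂ))) * conj (Y τ - ∫ y : ℝ, ((k (τ - y) : ℝ) : ℂ) * Y y))‖ ^ 2 := mul_le_mul_of_nonneg_left hlow hβ₀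
    _ ≤ _ := hmain
    _ ≤ (1 + (b₂ * q / (4 * G))) * ((1 + (b₂ * q / (4 * G))) * (nY * nL) + (1 + (b₂ * q / (4 * G))) * (nY * (G * (2 / q * (5 * Real.exp (-(X / 2)))) * nY)) + (L₂ * q / (4 * G)) * Λ * (nY * nW)
          + (2 * b₁ * (b₂ * q / (4 * G)) + 2 * (2 * G / q) * (b₂ * q / (4 * G)) ^ 2) * (nY * nY)) := by
        gcongr
    _ = _ := by ring

end Summit.NavierStokesRegularity.NavierStokesRegularity.Theorems.MatchedKernel

end
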